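/-
Copyright (c) 2026 the pub-hodgecm-mathlib formalisation cell (harness21).  Prover seat hodgecm-mathlib-F0P3a-p01 (g16), 2026-09-01.  Road «S3-ram» (LEAD F0P3a-plan (g12)
T11-61 «(r, ψ, a) existential»; owner F0P3a-p06 (g15)): organ (e3) «LEVI-ram CLAUSE», ψ-AGNOSTIC edition (any finite test family on `H_v`).
-/
import Literature.NumberTheory.Rogawski1990.DepthZeroKappaTransferLeviRamifiedOfFrame   -- ★ p846939 (p01 (g15)): (e3) C-Δ value discharged; ⊇ ★ p846879 core, ★ p846896, ★ p846921, ★ p846910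
import Literature.NumberTheory.Rogawski1990.LeviNearOneDeep                              -- ★ p846586 (O1): `exists_nhds_one_forall_levi_deep` (Levi eigenvalues 1-deep near `1`)
import HarnessLib

/-!
# The LEVI ROW of the depth-zero Δ‴-transfer at a TAME-RAMIFIED non-split place against an ARBITRARY FINITE TEST FAMILY on `H_v`
# (Rogawski (1990) §4.9 Prop. 4.9.1, §4.3 (4.3.1))

Topic `NumberTheory/Rogawski1990`; namespace `Literature.NumberTheory.Rogawski1990`.  KERNEL mathematics only: theorems, no definition, no named fact, no
instance, no notation, no `sorry`.  Cell `pub/hodgecm-mathlib`, crux H413 = `stmt-HodgeConjecture-24833`; road «S3-ram» (Literature seeding; LEAD F0P3a-plan (g12)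
T11-61 «`(r, ψ, a)` stay EXISTENTIAL until the profiles certificate names them»; architect A-p16 (g31) (Q2′) «the ramified test family `ψ^ram ⊇ ![χ⁰, χ♯]` may still be
refined»; owner F0P3a-p06 (g15)), organ **(e3) «LEVI-ram CLAUSE», ψ-AGNOSTIC EDITION**.  The (e3) files of record (★ p846879 core, ★ p846896, ★ p846921, ★ p846939)
state the Levi row against the inert pair `(χ₀, χ₁)`; END's last socket `stub_levelOneRowsRam` (fold v6 :118) asks for `∃ r ψ a` with an ARBITRARY finite family
`ψ : Fin r → C(H_v)`.  This file re-reads the three ★ heads against such a family: if every `ψH s` has a Levi value PROPORTIONAL to the `χ₀`-row near `1` (socket `hψ`,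
one row per test function: `χ₀ ↦ 1`, `χ₁ ↦ 0` ★ p846841; `χ♯ = 1_{K♯ × K₁} ↦ (q + 1)∕2` p07 (g13)), the Levi population tests the coefficients through ONE linear form:
  `Σᶠ_c Δ‴_v(γ_H, c)·Φ(c, g) = ∑ s, a s·Φ^st(γ_H, ψH s)` near `1` on the Levi population  ⟸  `(∑ s, a s·yv s)·ν_H(K_H) = ε·ν_G(K′)·X`,
(ε, X) as in the files of record.  PROOFS: the ★ head at `(a₀, a₁) := (∑ s, a s·yv s, 0)` + linearity; 1-deepness for `hψ` from ★ `exists_nhds_one_forall_levi_deep`.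
RESULTS: §1 `…_eq_sum_of_levi_ramified_of_orbital_eq` (core, sockets `hX hΔ hψ`), §2 `…_eq_sum_of_levi_ramified_of_frame` (rank-strata-constant pieces, C-Δ discharged),
§3 `…_eq_sum_of_levi_ramified_levelOne_of_frame_of_integral_eq` (fold v6 :118 binders VERBATIM, sockets `hN hψ`).  HONEST LABEL: HC_CM is proved only modulo the
cell's 2 remaining named inputs (hLiu418 24832, h413 24833) until rung 0 closes; «S3-ram» has no books consequence; this file discharges nothing by itself.

## References
* [Rogawski1990] J. D. Rogawski, *Automorphic Representations of Unitary Groups in Three Variables*, Ann. of Math. Stud. 123 (1990), §4.9 Prop. 4.9.1, (4.9.2) pp. 54–56; §4.3 p. 43.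
* [LanglandsShelstad1987] R. P. Langlands, D. Shelstad, *On the definition of transfer factors*, Math. Ann. 278 (1987), §1.3–1.4, §2.
* [Kottwitz1986] R. E. Kottwitz, *Base change for unit elements of Hecke algebras*, Compositio Math. 60 (1986), §3, §7.
-/

set_option autoImplicit false

noncomputable section

open NumberField IsDedekindDomain MeasureTheory Measure Topology Filter Matrix
open Literature.NumberTheory.Automorphic Literature.NumberTheory.Automorphic.UnitaryGroup Literature.NumberTheory.Automorphic.IntegralReduction
open Literature.NumberTheory.GaloisRepresentations Literature.NumberTheory.GaloisRepresentations.IsNonarchimedeanLocalField Literature.NumberTheory.QuadraticForms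
open scoped Matrix MatrixGroups NNReal ENNReal ValuativeRel

namespace Literature.NumberTheory.Rogawski1990

set_option maxHeartbeats 1600000 in
-- instance-term unification on the CM local carriers (as in ★ p846879)
open scoped Classical in
/-- **(e3) THE LEVI ROW AT A TAME-RAMIFIED PLACE AGAINST AN ARBITRARY FINITE TEST FAMILY — CORE** (ψ-agnostic edition of ★ p846879
`finsum_delta_mul_classOrbitalIntegral_eq_of_levi_ramified_of_orbital_eq`, same sockets `hX` (O2)-ram and `hΔ` C-Δram): for a family `ψH : Fin r → C(H_v)`
whose Levi values near `1` are `yv s`-PROPORTIONAL to the `χ₀`-row (socket `hψ`), the identity `Σᶠ_c Δ‴_v(γ_H, c)·Φ(c, g) = ∑ s, a s·Φ^st(γ_H, ψH s)` holds on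
the Levi population near `1` as soon as **`(∑ s, a s·yv s)·ν_H(K_H) = ε·ν_G(K′)·X`**. [cite: Rogawski1990, §4.9 Prop. 4.9.1 (a)(b) pp. 54–56; §4.3 (4.3.1) p. 43] -/
theorem finsum_delta_mul_classOrbitalIntegral_eq_sum_of_levi_ramified_of_orbital_eq
    (L : Type) [Field L] [NumberField L] [IsCMField L] (H' : Matrix (Fin 3) (Fin 3) L) (μ : HeckeCharacter L)
    {v : HeightOneSpectrum (𝓞 ↥(maximalRealSubfield L))}
    (hH' : (H'.map (cmConjRingHom L)).transpose = H') (w : PlacesOver L v)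
    (hw : IsCMField.complexConj L • w.1 = w.1) (he : v.asIdeal.ramificationIdx' w.1.asIdeal ≠ 1)
    -- good reduction (`_hH'i` idle: the frame binder `hframe`∕`hA` below carries the integrality; kept so the binder list is END's socket frame)
    (hH'w : IsUnit (placeForm H' w.1)) (_hH'i : hH'w.unit ∈ glInt 3 (w.1.adicCompletion L))
    (h2 : IsUnit (2 : 𝒪[w.1.adicCompletion L]))
    -- the integral antidiagonal FRAME of `H′_w` (END fold v2 socket binders; supplied at a tame-ramified `w` by ★ p846344 `exists_glInt_placeForm_eq_smul_formCongr_antidiagonal_of_neg`)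
    (A : GL (Fin 3) (w.1.adicCompletion L)) (hA : A ∈ glInt 3 (w.1.adicCompletion L))
    (hframe : placeForm H' w.1 = (-(placeForm H' w.1).det) • formCongr (galAdicCompletionMap (L := L) (IsCMField.complexConj L) hw) A ((StdForm.antidiagonal 3).over (w.1.adicCompletion L)))
    [MeasurableSpace ((cmDatum L 3 H').Local v)] [BorelSpace ((cmDatum L 3 H').Local v)]
    [∀ γ : ((cmDatum L 3 H').Local v), MeasurableSpace (((cmDatum L 3 H').Local v) ⧸ Subgroup.centralizer ({γ} : Set ((cmDatum L 3 H').Local v)))]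
    [∀ γ : ((cmDatum L 3 H').Local v), BorelSpace (((cmDatum L 3 H').Local v) ⧸ Subgroup.centralizer ({γ} : Set ((cmDatum L 3 H').Local v)))]
    [MeasurableSpace ((cmDatum L 2 (Matrix.of fun i j : Fin 2 => if i.val + j.val + 1 = 2 then (1 : L) else 0)).Local v ×
      (cmDatum L 1 (Matrix.of fun i j : Fin 1 => if i.val + j.val + 1 = 1 then (1 : L) else 0)).Local v)]
    [BorelSpace ((cmDatum L 2 (Matrix.of fun i j : Fin 2 => if i.val + j.val + 1 = 2 then (1 : L) else 0)).Local v ×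
      (cmDatum L 1 (Matrix.of fun i j : Fin 1 => if i.val + j.val + 1 = 1 then (1 : L) else 0)).Local v)]
    [∀ a : ((cmDatum L 2 (Matrix.of fun i j : Fin 2 => if i.val + j.val + 1 = 2 then (1 : L) else 0)).Local v ×
      (cmDatum L 1 (Matrix.of fun i j : Fin 1 => if i.val + j.val + 1 = 1 then (1 : L) else 0)).Local v),
      MeasurableSpace (((cmDatum L 2 (Matrix.of fun i j : Fin 2 => if i.val + j.val + 1 = 2 then (1 : L) else 0)).Local v ×
      (cmDatum L 1 (Matrix.of fun i j : Fin 1 => if i.val + j.val + 1 = 1 then (1 : L) else 0)).Local v) ⧸ Subgroup.centralizer ({a} : Set ((cmDatum L 2 (Matrix.of fun i j : Fin 2 => if i.val + j.val + 1 = 2 then (1 : L) else 0)).Local v ×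
      (cmDatum L 1 (Matrix.of fun i j : Fin 1 => if i.val + j.val + 1 = 1 then (1 : L) else 0)).Local v)))]
    [∀ a : ((cmDatum L 2 (Matrix.of fun i j : Fin 2 => if i.val + j.val + 1 = 2 then (1 : L) else 0)).Local v ×
      (cmDatum L 1 (Matrix.of fun i j : Fin 1 => if i.val + j.val + 1 = 1 then (1 : L) else 0)).Local v),
      BorelSpace (((cmDatum L 2 (Matrix.of fun i j : Fin 2 => if i.val + j.val + 1 = 2 then (1 : L) else 0)).Local v ×
      (cmDatum L 1 (Matrix.of fun i j : Fin 1 => if i.val + j.val + 1 = 1 then (1 : L) else 0)).Local v) ⧸ Subgroup.centralizer ({a} : Set ((cmDatum L 2 (Matrix.of fun i j : Fin 2 => if i.val + j.val + 1 = 2 then (1 : L) else 0)).Local v ×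
      (cmDatum L 1 (Matrix.of fun i j : Fin 1 => if i.val + j.val + 1 = 1 then (1 : L) else 0)).Local v)))]
    (νH : Measure ((cmDatum L 2 (Matrix.of fun i j : Fin 2 => if i.val + j.val + 1 = 2 then (1 : L) else 0)).Local v ×
      (cmDatum L 1 (Matrix.of fun i j : Fin 1 => if i.val + j.val + 1 = 1 then (1 : L) else 0)).Local v)) [νH.IsHaarMeasure] [νH.IsMulRightInvariant]
    (νG : Measure ((cmDatum L 3 H').Local v)) [νG.IsHaarMeasure] [νG.IsMulRightInvariant]
    {mH : OrbitalMeasureFamily ((cmDatum L 2 (Matrix.of fun i j : Fin 2 => if i.val + j.val + 1 = 2 then (1 : L) else 0)).Local v ×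
      (cmDatum L 1 (Matrix.of fun i j : Fin 1 => if i.val + j.val + 1 = 1 then (1 : L) else 0)).Local v)} {mG : OrbitalMeasureFamily ((cmDatum L 3 H').Local v)}
    (hmH : mH.IsCanonical (IsLocalGRegular L v) νH)
    (_hmG : mG.IsCanonical (fun γ => IsRegularElt (γ.val : GL (Fin 3) (UnitaryGroup.LocalRing L v))) νG)
    -- the piece (only its `G`-side value `hX` is used)
    (g : ((cmDatum L 3 H').Local v) → ℂ)
    -- the depth predicate on the Levi eigenvalues, holding near `1`, at least 1-deep
    (deep : (Fin 3 → (UnitaryGroup.LocalRing L v)ˣ) → Prop)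
    (hV : ∃ V ∈ 𝓝 (1 : (cmDatum L 2 (Matrix.of fun i j : Fin 2 => if i.val + j.val + 1 = 2 then (1 : L) else 0)).Local v ×
        (cmDatum L 1 (Matrix.of fun i j : Fin 1 => if i.val + j.val + 1 = 1 then (1 : L) else 0)).Local v),
      ∀ γH ∈ V, ∀ (y : (cmDatum L 2 (Matrix.of fun i j : Fin 2 => if i.val + j.val + 1 = 2 then (1 : L) else 0)).Local v ×
        (cmDatum L 1 (Matrix.of fun i j : Fin 1 => if i.val + j.val + 1 = 1 then (1 : L) else 0)).Local v) (d : Fin 3 → (UnitaryGroup.LocalRing L v)ˣ),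
        ((endoEmbLocal L v (y * γH * y⁻¹)).val : GL (Fin 3) (UnitaryGroup.LocalRing L v)) = glDiagonal 3 (UnitaryGroup.LocalRing L v) d → deep d)
    (hdeep1 : ∀ d : Fin 3 → (UnitaryGroup.LocalRing L v)ˣ, deep d → ∀ i : Fin 3, Valued.v ((((d i : (UnitaryGroup.LocalRing L v)ˣ) : UnitaryGroup.LocalRing L v) w) - 1) < 1)
    -- SOCKET (O2)-ram: the `G`-side value at the deep regular split torus, through ANY level-preserving frame (binders VERBATIM ★ p846740's `hX`)
    (X ε : ℂ)
    (hX : ∀ [MeasurableSpace ↥(unitaryGroupOfForm (conjLocal L (IsCMField.complexConj L) v) (cmLocalForm L 3 v))] [BorelSpace ↥(unitaryGroupOfForm (conjLocal L (IsCMField.complexConj L) v) (cmLocalForm L 3 v))]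
      (ψ : (cmDatum L 3 H').Local v ≃ₜ* ↥(unitaryGroupOfForm (conjLocal L (IsCMField.complexConj L) v) (cmLocalForm L 3 v)))
      (_hψK : ∀ g : (cmDatum L 3 H').Local v, ψ g ∈ cmLocalIntegralLevel L 3 (Matrix.of fun i j : Fin 3 => if i.val + j.val + 1 = 3 then (1 : L) else 0) v ↔ g ∈ cmLocalIntegralLevel L 3 H' v)
      (_hψc : ∀ g : (cmDatum L 3 H').Local v, IsConj (g.val : GL (Fin 3) (LocalRing L v)) ((ψ g : ↥(unitaryGroupOfForm (conjLocal L (IsCMField.complexConj L) v) (cmLocalForm L 3 v))) : GL (Fin 3) (LocalRing L v)))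
      (T : GL (Fin 3) (w.1.adicCompletion L)) (_hT : T ∈ glInt 3 (w.1.adicCompletion L))
      (_hψT : ∀ g : (cmDatum L 3 H').Local v, localGLPiEquiv L 3 v (((ψ g : ↥(unitaryGroupOfForm (conjLocal L (IsCMField.complexConj L) v) (cmLocalForm L 3 v)))) : GL (Fin 3) (LocalRing L v)) w =
        T * localGLPiEquiv L 3 v (g.val : GL (Fin 3) (LocalRing L v)) w * T⁻¹)
      (μN : Measure ↥(unipotentU (conjLocal L (IsCMField.complexConj L) v) (cmLocalForm L 3 v))) [μN.IsHaarMeasure]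
      (t : ↥(torusU (conjLocal L (IsCMField.complexConj L) v) (cmLocalForm L 3 v))) (d : Fin 3 → (LocalRing L v)ˣ)
      (hd : glDiagonal 3 (LocalRing L v) d = ((t : ↥(unitaryGroupOfForm (conjLocal L (IsCMField.complexConj L) v) (cmLocalForm L 3 v))) : GL (Fin 3) (LocalRing L v)))
      (_hreg : ∀ i j, i ≠ j → IsUnit ((d i : LocalRing L v) - d j))
      (ha' : IsUnit ((((d 0)⁻¹ * d 1 : (LocalRing L v)ˣ) : LocalRing L v) - 1)) (hb' : IsUnit ((((d 0)⁻¹ * d 2 : (LocalRing L v)ˣ) : LocalRing L v) - 1))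
      (_hdp : deep d) (γ₀ : (cmDatum L 3 H').Local v) (_hγ₀ : ψ γ₀ = (t : ↥(unitaryGroupOfForm (conjLocal L (IsCMField.complexConj L) v) (cmLocalForm L 3 v)))),
      classOrbitalIntegral mG g (ConjClasses.mk γ₀) =
        (νG.real (cmLocalIntegralLevel L 3 H' v : Set ((cmDatum L 3 H').Local v)) : ℂ) * (((letI : MeasurableSpace (LocalRing L v) := borel _; haveI : BorelSpace (LocalRing L v) := ⟨rfl⟩
          haveI : SecondCountableTopology (LocalRing L v) := secondCountableTopology_localRing (E := L) v
          ((distribHaarChar (LocalRing L v) ha'.unit)⁻¹ *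
            (HeisRing.skewModulus (conjLocal L (IsCMField.complexConj L) v) (continuous_conjLocal L (IsCMField.complexConj L) v) hb'.unit
              (HeisRing.map_unit_torusCentralScalar_sub_one (conjLocal L (IsCMField.complexConj L) v) (cmLocalForm_eq_over L 3 v) t hd hb'))⁻¹ :
                ℝ≥0)) : ℝ≥0) : ℂ) * X)
    -- SOCKET C-Δram: the LEVI VALUE of Rogawski's explicit factor near `1`, `Δ‴_v(γ₁, γ₀) = ε·‖a − 1‖` (binders = ★ T5-Levi `finExplicitDelta_eq_unitModulusChar_of_levi_of_nonsplit`'s)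
    (hΔ : ∃ VΔ ∈ 𝓝 (1 : ((cmDatum L 2 (Matrix.of fun i j : Fin 2 => if i.val + j.val + 1 = 2 then (1 : L) else 0)).Local v ×
        (cmDatum L 1 (Matrix.of fun i j : Fin 1 => if i.val + j.val + 1 = 1 then (1 : L) else 0)).Local v)),
      ∀ γH ∈ VΔ, ∀ (y : ((cmDatum L 2 (Matrix.of fun i j : Fin 2 => if i.val + j.val + 1 = 2 then (1 : L) else 0)).Local v ×
        (cmDatum L 1 (Matrix.of fun i j : Fin 1 => if i.val + j.val + 1 = 1 then (1 : L) else 0)).Local v)) (d : Fin 3 → (UnitaryGroup.LocalRing L v)ˣ),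
        ((endoEmbLocal L v (y * γH * y⁻¹)).val : GL (Fin 3) (UnitaryGroup.LocalRing L v)) = glDiagonal 3 (UnitaryGroup.LocalRing L v) d →
        (∀ i j, i ≠ j → IsUnit ((d i : UnitaryGroup.LocalRing L v) - d j)) →
        endoEmbLocal L v (y * γH * y⁻¹) ∈ cmLocalIntegralLevel L 3 (Matrix.of fun i j : Fin 3 => if i.val + j.val + 1 = 3 then (1 : L) else 0) v →
        ∀ (ha : IsUnit ((((d 0)⁻¹ * d 1 : (UnitaryGroup.LocalRing L v)ˣ) : UnitaryGroup.LocalRing L v) - 1)) (γ₀ : (cmDatum L 3 H').Local v),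
          IsLocalNormPair L H' v (y * γH * y⁻¹) γ₀ →
          finExplicitDelta L v H' (y * γH * y⁻¹) μ γ₀ = ε * (((unitModulusChar (UnitaryGroup.LocalRing L v) ha.unit : ℝ≥0) : ℝ) : ℂ))
    -- the TEST FAMILY (fold v6 :118 shape `∃ r ψ a`) with its LEVI PROPORTIONALITY CONSTANTS `yv`; SOCKET `hψ`: near `1`, `Φ^st(γ_H, ψH s) = yv s·Φ^st(γ_H, χ₀)` on 1-deep regular Levi `γ_H`
    {r : ℕ} (ψH : Fin r → ((cmDatum L 2 (Matrix.of fun i j : Fin 2 => if i.val + j.val + 1 = 2 then (1 : L) else 0)).Local v ×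
        (cmDatum L 1 (Matrix.of fun i j : Fin 1 => if i.val + j.val + 1 = 1 then (1 : L) else 0)).Local v) → ℂ) (yv a : Fin r → ℂ)
    (hψ : ∃ Vψ ∈ 𝓝 (1 : ((cmDatum L 2 (Matrix.of fun i j : Fin 2 => if i.val + j.val + 1 = 2 then (1 : L) else 0)).Local v ×
        (cmDatum L 1 (Matrix.of fun i j : Fin 1 => if i.val + j.val + 1 = 1 then (1 : L) else 0)).Local v)),
      ∀ γH ∈ Vψ, IsLocalGRegular L v γH →
        ∀ (y : ((cmDatum L 2 (Matrix.of fun i j : Fin 2 => if i.val + j.val + 1 = 2 then (1 : L) else 0)).Local v ×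
        (cmDatum L 1 (Matrix.of fun i j : Fin 1 => if i.val + j.val + 1 = 1 then (1 : L) else 0)).Local v)) (d' : Fin 2 → (UnitaryGroup.LocalRing L v)ˣ),
          glDiagonal 2 (UnitaryGroup.LocalRing L v) d' = ((y * γH * y⁻¹).1.val : GL (Fin 2) (UnitaryGroup.LocalRing L v)) →
          (∀ i : Fin 2, Valued.v ((((d' i : (UnitaryGroup.LocalRing L v)ˣ) : UnitaryGroup.LocalRing L v) w) - 1) < 1) →
          ∀ s, stableOrbitalIntegralRel (IsLocalStablyConjH L v) mH (ψH s) γH =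
            yv s * stableOrbitalIntegralRel (IsLocalStablyConjH L v) mH
                ((((cmLocalIntegralLevel L 2 (Matrix.of fun i j : Fin 2 => if i.val + j.val + 1 = 2 then (1 : L) else 0) v).prod
                (cmLocalIntegralLevel L 1 (Matrix.of fun i j : Fin 1 => if i.val + j.val + 1 = 1 then (1 : L) else 0) v) : Subgroup _) : Set _).indicator
              (fun h => if (redMat (((h.1.val : GL (Fin 2) (UnitaryGroup.LocalRing L v)).val.map (Pi.evalRingHom (fun w' : PlacesOver L v => w'.1.adicCompletion L) w))) - 1) ^ 2 = 0 ∧ (redMat (((h.1.val : GL (Fin 2) (UnitaryGroup.LocalRing L v)).val.map (Pi.evalRingHom (fun w' : PlacesOver L v => w'.1.adicCompletion L) w))) - 1).rank = 0 then (1 : ℂ) else 0)) γH)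
    -- the coefficient test: ONE linear relation on `a` (the Levi population sees only `∑ s, a s·yv s`)
    (ha : (∑ s, a s * yv s) * (νH.real (((cmLocalIntegralLevel L 2 (Matrix.of fun i j : Fin 2 => if i.val + j.val + 1 = 2 then (1 : L) else 0) v).prod
                (cmLocalIntegralLevel L 1 (Matrix.of fun i j : Fin 1 => if i.val + j.val + 1 = 1 then (1 : L) else 0) v) : Subgroup _) : Set _) : ℂ) =
            ε * (νG.real (cmLocalIntegralLevel L 3 H' v : Set ((cmDatum L 3 H').Local v)) : ℂ) * X) :
        ∃ V ∈ 𝓝 (1 : ((cmDatum L 2 (Matrix.of fun i j : Fin 2 => if i.val + j.val + 1 = 2 then (1 : L) else 0)).Local v ×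
        (cmDatum L 1 (Matrix.of fun i j : Fin 1 => if i.val + j.val + 1 = 1 then (1 : L) else 0)).Local v)),
      ∀ γH ∈ V, IsLocalGRegular L v γH →
        (∃ (y : ((cmDatum L 2 (Matrix.of fun i j : Fin 2 => if i.val + j.val + 1 = 2 then (1 : L) else 0)).Local v ×
        (cmDatum L 1 (Matrix.of fun i j : Fin 1 => if i.val + j.val + 1 = 1 then (1 : L) else 0)).Local v)) (d' : Fin 2 → (UnitaryGroup.LocalRing L v)ˣ),
          glDiagonal 2 (UnitaryGroup.LocalRing L v) d' = ((y * γH * y⁻¹).1.val : GL (Fin 2) (UnitaryGroup.LocalRing L v))) →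
        ∑ᶠ cG : ConjClasses ((cmDatum L 3 H').Local v),
            ((finExplicitCollection L H' μ (finExplicitDelta_conj_left_all L H' μ) (finExplicitDelta_conj_right_all L H' μ)) v).Δ γH (Quotient.out cG) *
              classOrbitalIntegral mG g cG =
          ∑ s, a s * stableOrbitalIntegralRel (IsLocalStablyConjH L v) mH (ψH s) γH := by
  -- ★ p846879 at `(a₀, a₁) := (∑ s, a s·yv s, 0)`
  have hw' := finsum_delta_mul_classOrbitalIntegral_eq_of_levi_ramified_of_orbital_eq L H' μ hH' w hw he hH'w _hH'i h2 A hA hframe νH νG hmH _hmG g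
    deep hV hdeep1 X (∑ s, a s * yv s) 0 ε hX hΔ ha
  obtain ⟨V, hV1, hVc⟩ := hw'
  obtain ⟨Vψ, hVψ1, hVψ⟩ := hψ
  obtain ⟨V₁, hV₁1, hV₁⟩ := exists_nhds_one_forall_levi_deep L v w  -- 1-deepness of the Levi eigenvalues near `1`, fed to `hψ`
  refine ⟨V ∩ (Vψ ∩ V₁), Filter.inter_mem hV1 (Filter.inter_mem hVψ1 hV₁1), fun γH hγ hreg hlev => ?_⟩
  have h1 := hVc γH hγ.1 hreg hlev
  obtain ⟨y, d', hyd'⟩ := hlev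
  have ht1 : ∀ i : Fin 2, Valued.v ((((d' i : (UnitaryGroup.LocalRing L v)ˣ) : UnitaryGroup.LocalRing L v) w) - 1) < 1 := by
    have h3 := hV₁ γH hγ.2.2 y _ (endoEmbLocal_eq_glDiagonal_of_fst_eq L v (y * γH * y⁻¹) hyd')
    intro i
    fin_cases i
    · exact h3 0
    · exact h3 2
  have h2 := hVψ γH hγ.2.1 hreg y d' hyd' ht1
  rw [h1, zero_mul, add_zero, Finset.sum_mul]
  exact Finset.sum_congr rfl fun s _ => by rw [h2 s]; ring

set_option maxHeartbeats 1600000 in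
-- instance-term unification on the CM local carriers (as in ★ p846879)
open scoped Classical in
/-- **(e3) THE LEVI ROW AT A TAME-RAMIFIED PLACE FOR A RANK-STRATA-CONSTANT `K`-CLASS PIECE AGAINST AN ARBITRARY FINITE TEST FAMILY — C-Δ VALUE
DISCHARGED** (ψ-agnostic edition of ★ p846939 `finsum_delta_mul_classOrbitalIntegral_eq_of_levi_ramified_of_frame`): with END's frame `(A hA hframe)`, `y_λ` with
`ι_w y_λ = −det H′_w`, the guard `μ|_{𝕀_{L⁺}} = ω` and the proportionality socket `hψ`, the identity holds on the Levi population near `1` whenever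
**`(∑ s, a s·yv s)·ν_H(K_H) = (y_λ, θ)_v·ν_G(K′)·q⁻¹·(c₀ + (q − 1)c₂)`**. [cite: Rogawski1990, §4.9 Prop. 4.9.1 (a)(b) pp. 54–56; §4.3 (4.3.1) p. 43] -/
theorem finsum_delta_mul_classOrbitalIntegral_eq_sum_of_levi_ramified_of_frame
    (L : Type) [Field L] [NumberField L] [IsCMField L] (H' : Matrix (Fin 3) (Fin 3) L) (μ : HeckeCharacter L)
    {v : HeightOneSpectrum (𝓞 ↥(maximalRealSubfield L))}
    (hH' : (H'.map (cmConjRingHom L)).transpose = H') (w : PlacesOver L v)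
    (hw : IsCMField.complexConj L • w.1 = w.1) (he : v.asIdeal.ramificationIdx' w.1.asIdeal ≠ 1)
    -- good reduction (`_hH'i` idle: the frame binder `hframe`∕`hA` below carries the integrality; kept so the binder list is END's socket frame)
    (hH'w : IsUnit (placeForm H' w.1)) (_hH'i : hH'w.unit ∈ glInt 3 (w.1.adicCompletion L))
    (h2 : IsUnit (2 : 𝒪[w.1.adicCompletion L]))
    -- the integral antidiagonal FRAME of `H′_w` (END fold v2 socket binders; supplied at a tame-ramified `w` by ★ p846344 `exists_glInt_placeForm_eq_smul_formCongr_antidiagonal_of_neg`)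
    (A : GL (Fin 3) (w.1.adicCompletion L)) (hA : A ∈ glInt 3 (w.1.adicCompletion L))
    (hframe : placeForm H' w.1 = (-(placeForm H' w.1).det) • formCongr (galAdicCompletionMap (L := L) (IsCMField.complexConj L) hw) A ((StdForm.antidiagonal 3).over (w.1.adicCompletion L)))
    [MeasurableSpace ((cmDatum L 3 H').Local v)] [BorelSpace ((cmDatum L 3 H').Local v)]
    [∀ γ : ((cmDatum L 3 H').Local v), MeasurableSpace (((cmDatum L 3 H').Local v) ⧸ Subgroup.centralizer ({γ} : Set ((cmDatum L 3 H').Local v)))]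
    [∀ γ : ((cmDatum L 3 H').Local v), BorelSpace (((cmDatum L 3 H').Local v) ⧸ Subgroup.centralizer ({γ} : Set ((cmDatum L 3 H').Local v)))]
    [MeasurableSpace ((cmDatum L 2 (Matrix.of fun i j : Fin 2 => if i.val + j.val + 1 = 2 then (1 : L) else 0)).Local v ×
      (cmDatum L 1 (Matrix.of fun i j : Fin 1 => if i.val + j.val + 1 = 1 then (1 : L) else 0)).Local v)]
    [BorelSpace ((cmDatum L 2 (Matrix.of fun i j : Fin 2 => if i.val + j.val + 1 = 2 then (1 : L) else 0)).Local v ×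
      (cmDatum L 1 (Matrix.of fun i j : Fin 1 => if i.val + j.val + 1 = 1 then (1 : L) else 0)).Local v)]
    [∀ a : ((cmDatum L 2 (Matrix.of fun i j : Fin 2 => if i.val + j.val + 1 = 2 then (1 : L) else 0)).Local v ×
      (cmDatum L 1 (Matrix.of fun i j : Fin 1 => if i.val + j.val + 1 = 1 then (1 : L) else 0)).Local v),
      MeasurableSpace (((cmDatum L 2 (Matrix.of fun i j : Fin 2 => if i.val + j.val + 1 = 2 then (1 : L) else 0)).Local v ×
      (cmDatum L 1 (Matrix.of fun i j : Fin 1 => if i.val + j.val + 1 = 1 then (1 : L) else 0)).Local v) ⧸ Subgroup.centralizer ({a} : Set ((cmDatum L 2 (Matrix.of fun i j : Fin 2 => if i.val + j.val + 1 = 2 then (1 : L) else 0)).Local v ×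
      (cmDatum L 1 (Matrix.of fun i j : Fin 1 => if i.val + j.val + 1 = 1 then (1 : L) else 0)).Local v)))]
    [∀ a : ((cmDatum L 2 (Matrix.of fun i j : Fin 2 => if i.val + j.val + 1 = 2 then (1 : L) else 0)).Local v ×
      (cmDatum L 1 (Matrix.of fun i j : Fin 1 => if i.val + j.val + 1 = 1 then (1 : L) else 0)).Local v),
      BorelSpace (((cmDatum L 2 (Matrix.of fun i j : Fin 2 => if i.val + j.val + 1 = 2 then (1 : L) else 0)).Local v ×
      (cmDatum L 1 (Matrix.of fun i j : Fin 1 => if i.val + j.val + 1 = 1 then (1 : L) else 0)).Local v) ⧸ Subgroup.centralizer ({a} : Set ((cmDatum L 2 (Matrix.of fun i j : Fin 2 => if i.val + j.val + 1 = 2 then (1 : L) else 0)).Local v ×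
      (cmDatum L 1 (Matrix.of fun i j : Fin 1 => if i.val + j.val + 1 = 1 then (1 : L) else 0)).Local v)))]
    (νH : Measure ((cmDatum L 2 (Matrix.of fun i j : Fin 2 => if i.val + j.val + 1 = 2 then (1 : L) else 0)).Local v ×
      (cmDatum L 1 (Matrix.of fun i j : Fin 1 => if i.val + j.val + 1 = 1 then (1 : L) else 0)).Local v)) [νH.IsHaarMeasure] [νH.IsMulRightInvariant]
    (νG : Measure ((cmDatum L 3 H').Local v)) [νG.IsHaarMeasure] [νG.IsMulRightInvariant]
    {mH : OrbitalMeasureFamily ((cmDatum L 2 (Matrix.of fun i j : Fin 2 => if i.val + j.val + 1 = 2 then (1 : L) else 0)).Local v ×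
      (cmDatum L 1 (Matrix.of fun i j : Fin 1 => if i.val + j.val + 1 = 1 then (1 : L) else 0)).Local v)} {mG : OrbitalMeasureFamily ((cmDatum L 3 H').Local v)}
    (hmH : mH.IsCanonical (IsLocalGRegular L v) νH)
    (hmG : mG.IsCanonical (fun γ => IsRegularElt (γ.val : GL (Fin 3) (UnitaryGroup.LocalRing L v))) νG)
    -- the depth-zero piece: `C_c^∞`, supported in `K′`, `Ad K′`-invariant, constant `c r` on the residual-rank-`r` unipotent stratum (★ p846693's binders VERBATIM)
    (g : ((cmDatum L 3 H').Local v) → ℂ) (hg : IsLocSmooth g) (hgK : tsupport g ⊆ (cmLocalIntegralLevel L 3 H' v : Set ((cmDatum L 3 H').Local v)))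
    (hginv : ∀ u ∈ cmLocalIntegralLevel L 3 H' v, ∀ x, g (u * x * u⁻¹) = g x)
    (c : ℕ → ℂ)
    (hc : ∀ k ∈ cmLocalIntegralLevel L 3 H' v,
      (redMat (((k.val : GL (Fin 3) (UnitaryGroup.LocalRing L v)).val.map (Pi.evalRingHom (fun w' : PlacesOver L v => w'.1.adicCompletion L) w))) - 1) ^ 3 = 0 →
      g k = c (redMat (((k.val : GL (Fin 3) (UnitaryGroup.LocalRing L v)).val.map (Pi.evalRingHom (fun w' : PlacesOver L v => w'.1.adicCompletion L) w))) - 1).rank)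
    -- the C-Δ LEVI VALUE is DISCHARGED (★ p846910, p07 (g12)): guard `μ|_{𝕀_{L⁺}} = ω` and `y_λ ∈ L⁺_v` with `ι_w y_λ = −det H′_w` (the core's epsilon is `(y_λ, θ)_v`)
    (hμω : ∀ x : ideleGroup ↥(maximalRealSubfield L), μ (AdeleRing.ideleBaseChange ↥(maximalRealSubfield L) L x) = quadraticHeckeCharCM L x)
    (yl : v.adicCompletion ↥(maximalRealSubfield L)) (hyl : toPlace v w yl = -(placeForm H' w.1).det)
    -- the TEST FAMILY (fold v6 :118 shape `∃ r ψ a`) with its LEVI PROPORTIONALITY CONSTANTS `yv`; SOCKET `hψ`: near `1`, `Φ^st(γ_H, ψH s) = yv s·Φ^st(γ_H, χ₀)` on 1-deep regular Levi `γ_H`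
    {r : ℕ} (ψH : Fin r → ((cmDatum L 2 (Matrix.of fun i j : Fin 2 => if i.val + j.val + 1 = 2 then (1 : L) else 0)).Local v ×
        (cmDatum L 1 (Matrix.of fun i j : Fin 1 => if i.val + j.val + 1 = 1 then (1 : L) else 0)).Local v) → ℂ) (yv a : Fin r → ℂ)
    (hψ : ∃ Vψ ∈ 𝓝 (1 : ((cmDatum L 2 (Matrix.of fun i j : Fin 2 => if i.val + j.val + 1 = 2 then (1 : L) else 0)).Local v ×
        (cmDatum L 1 (Matrix.of fun i j : Fin 1 => if i.val + j.val + 1 = 1 then (1 : L) else 0)).Local v)),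
      ∀ γH ∈ Vψ, IsLocalGRegular L v γH →
        ∀ (y : ((cmDatum L 2 (Matrix.of fun i j : Fin 2 => if i.val + j.val + 1 = 2 then (1 : L) else 0)).Local v ×
        (cmDatum L 1 (Matrix.of fun i j : Fin 1 => if i.val + j.val + 1 = 1 then (1 : L) else 0)).Local v)) (d' : Fin 2 → (UnitaryGroup.LocalRing L v)ˣ),
          glDiagonal 2 (UnitaryGroup.LocalRing L v) d' = ((y * γH * y⁻¹).1.val : GL (Fin 2) (UnitaryGroup.LocalRing L v)) →
          (∀ i : Fin 2, Valued.v ((((d' i : (UnitaryGroup.LocalRing L v)ˣ) : UnitaryGroup.LocalRing L v) w) - 1) < 1) →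
          ∀ s, stableOrbitalIntegralRel (IsLocalStablyConjH L v) mH (ψH s) γH =
            yv s * stableOrbitalIntegralRel (IsLocalStablyConjH L v) mH
                ((((cmLocalIntegralLevel L 2 (Matrix.of fun i j : Fin 2 => if i.val + j.val + 1 = 2 then (1 : L) else 0) v).prod
                (cmLocalIntegralLevel L 1 (Matrix.of fun i j : Fin 1 => if i.val + j.val + 1 = 1 then (1 : L) else 0) v) : Subgroup _) : Set _).indicator
              (fun h => if (redMat (((h.1.val : GL (Fin 2) (UnitaryGroup.LocalRing L v)).val.map (Pi.evalRingHom (fun w' : PlacesOver L v => w'.1.adicCompletion L) w))) - 1) ^ 2 = 0 ∧ (redMat (((h.1.val : GL (Fin 2) (UnitaryGroup.LocalRing L v)).val.map (Pi.evalRingHom (fun w' : PlacesOver L v => w'.1.adicCompletion L) w))) - 1).rank = 0 then (1 : ℂ) else 0)) γH)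
    -- the coefficient test with the TAME-RAMIFIED Levi column `X = q⁻¹·(c₀ + (q − 1)c₂)` of ★ (O2)-ram: ONE linear relation on `a`
    (ha : (∑ s, a s * yv s) * (νH.real (((cmLocalIntegralLevel L 2 (Matrix.of fun i j : Fin 2 => if i.val + j.val + 1 = 2 then (1 : L) else 0) v).prod
                (cmLocalIntegralLevel L 1 (Matrix.of fun i j : Fin 1 => if i.val + j.val + 1 = 1 then (1 : L) else 0) v) : Subgroup _) : Set _) : ℂ) =
            (hilbertSymbol (v.adicCompletion ↥(maximalRealSubfield L)) yl
        (algebraMap ↥(maximalRealSubfield L) _ ((cmQuadraticGenerator L : 𝓞 ↥(maximalRealSubfield L)) : ↥(maximalRealSubfield L))) : ℂ) *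
        (νG.real (cmLocalIntegralLevel L 3 H' v : Set ((cmDatum L 3 H').Local v)) : ℂ) *
        ((Ideal.absNorm v.asIdeal : ℂ)⁻¹ * (c 0 * 1 + c 1 * 0 + c 2 * ((Ideal.absNorm v.asIdeal : ℂ) - 1)))) :
        ∃ V ∈ 𝓝 (1 : ((cmDatum L 2 (Matrix.of fun i j : Fin 2 => if i.val + j.val + 1 = 2 then (1 : L) else 0)).Local v ×
        (cmDatum L 1 (Matrix.of fun i j : Fin 1 => if i.val + j.val + 1 = 1 then (1 : L) else 0)).Local v)),
      ∀ γH ∈ V, IsLocalGRegular L v γH →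
        (∃ (y : ((cmDatum L 2 (Matrix.of fun i j : Fin 2 => if i.val + j.val + 1 = 2 then (1 : L) else 0)).Local v ×
        (cmDatum L 1 (Matrix.of fun i j : Fin 1 => if i.val + j.val + 1 = 1 then (1 : L) else 0)).Local v)) (d' : Fin 2 → (UnitaryGroup.LocalRing L v)ˣ),
          glDiagonal 2 (UnitaryGroup.LocalRing L v) d' = ((y * γH * y⁻¹).1.val : GL (Fin 2) (UnitaryGroup.LocalRing L v))) →
        ∑ᶠ cG : ConjClasses ((cmDatum L 3 H').Local v),
            ((finExplicitCollection L H' μ (finExplicitDelta_conj_left_all L H' μ) (finExplicitDelta_conj_right_all L H' μ)) v).Δ γH (Quotient.out cG) *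
              classOrbitalIntegral mG g cG =
          ∑ s, a s * stableOrbitalIntegralRel (IsLocalStablyConjH L v) mH (ψH s) γH := by
  -- ★ p846939 §1 at `(a₀, a₁) := (∑ s, a s·yv s, 0)`
  have hw' := finsum_delta_mul_classOrbitalIntegral_eq_of_levi_ramified_of_frame L H' μ hH' w hw he hH'w _hH'i h2 A hA hframe νH νG hmH hmG
    g hg hgK hginv c hc hμω yl hyl (a₀ := ∑ s, a s * yv s) (a₁ := 0) ha
  obtain ⟨V, hV1, hVc⟩ := hw'
  obtain ⟨Vψ, hVψ1, hVψ⟩ := hψ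
  obtain ⟨V₁, hV₁1, hV₁⟩ := exists_nhds_one_forall_levi_deep L v w  -- 1-deepness of the Levi eigenvalues near `1`, fed to `hψ`
  refine ⟨V ∩ (Vψ ∩ V₁), Filter.inter_mem hV1 (Filter.inter_mem hVψ1 hV₁1), fun γH hγ hreg hlev => ?_⟩
  have h1 := hVc γH hγ.1 hreg hlev
  obtain ⟨y, d', hyd'⟩ := hlev
  have ht1 : ∀ i : Fin 2, Valued.v ((((d' i : (UnitaryGroup.LocalRing L v)ˣ) : UnitaryGroup.LocalRing L v) w) - 1) < 1 := by
    have h3 := hV₁ γH hγ.2.2 y _ (endoEmbLocal_eq_glDiagonal_of_fst_eq L v (y * γH * y⁻¹) hyd')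
    intro i
    fin_cases i
    · exact h3 0
    · exact h3 2
  have h2 := hVψ γH hγ.2.1 hreg y d' hyd' ht1
  rw [h1, zero_mul, add_zero, Finset.sum_mul]
  exact Finset.sum_congr rfl fun s _ => by rw [h2 s]; ring

set_option maxHeartbeats 1600000 in
-- instance-term unification on the CM local carriers (as in ★ p846879)
open scoped Classical in
/-- **(e3) THE LEVI ROW AT A TAME-RAMIFIED PLACE FOR A LEFT-`K(ϖ_v)`-INVARIANT `K`-CLASS PIECE AGAINST AN ARBITRARY FINITE TEST FAMILY** (END fold v6
`stub_levelOneRowsRam` :118 currency — its binders and its `∃ r ψ a` right-hand side token for token; ψ-agnostic edition of ★ p846939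
`finsum_delta_mul_classOrbitalIntegral_eq_of_levi_ramified_levelOne_of_frame_of_integral_eq`): sockets `hN` (the `N ∩ K₃`-integral of `g∘ψ⁻¹` through every
integral level frame) and `hψ`; test **`(∑ s, a s·yv s)·ν_H(K_H) = (y_λ, θ)_v·ν_G(K′)·X`**. [cite: Rogawski1990, §4.9 Prop. 4.9.1 (a)(b) pp. 54–56; §4.3 (4.3.1) p. 43] -/
theorem finsum_delta_mul_classOrbitalIntegral_eq_sum_of_levi_ramified_levelOne_of_frame_of_integral_eq
    (L : Type) [Field L] [NumberField L] [IsCMField L] (H' : Matrix (Fin 3) (Fin 3) L) (μ : HeckeCharacter L)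
    {v : HeightOneSpectrum (𝓞 ↥(maximalRealSubfield L))}
    (hH' : (H'.map (cmConjRingHom L)).transpose = H') (w : PlacesOver L v)
    (hw : IsCMField.complexConj L • w.1 = w.1) (he : v.asIdeal.ramificationIdx' w.1.asIdeal ≠ 1)
    -- good reduction (`_hH'i` idle: the frame binder `hframe`∕`hA` below carries the integrality; kept so the binder list is END's socket frame)
    (hH'w : IsUnit (placeForm H' w.1)) (_hH'i : hH'w.unit ∈ glInt 3 (w.1.adicCompletion L))
    (h2 : IsUnit (2 : 𝒪[w.1.adicCompletion L]))
    -- the integral antidiagonal FRAME of `H′_w` (END fold v2 socket binders; supplied at a tame-ramified `w` by ★ p846344 `exists_glInt_placeForm_eq_smul_formCongr_antidiagonal_of_neg`)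
    (A : GL (Fin 3) (w.1.adicCompletion L)) (hA : A ∈ glInt 3 (w.1.adicCompletion L))
    (hframe : placeForm H' w.1 = (-(placeForm H' w.1).det) • formCongr (galAdicCompletionMap (L := L) (IsCMField.complexConj L) hw) A ((StdForm.antidiagonal 3).over (w.1.adicCompletion L)))
    [MeasurableSpace ((cmDatum L 3 H').Local v)] [BorelSpace ((cmDatum L 3 H').Local v)]
    [∀ γ : ((cmDatum L 3 H').Local v), MeasurableSpace (((cmDatum L 3 H').Local v) ⧸ Subgroup.centralizer ({γ} : Set ((cmDatum L 3 H').Local v)))]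
    [∀ γ : ((cmDatum L 3 H').Local v), BorelSpace (((cmDatum L 3 H').Local v) ⧸ Subgroup.centralizer ({γ} : Set ((cmDatum L 3 H').Local v)))]
    [MeasurableSpace ((cmDatum L 2 (Matrix.of fun i j : Fin 2 => if i.val + j.val + 1 = 2 then (1 : L) else 0)).Local v ×
      (cmDatum L 1 (Matrix.of fun i j : Fin 1 => if i.val + j.val + 1 = 1 then (1 : L) else 0)).Local v)]
    [BorelSpace ((cmDatum L 2 (Matrix.of fun i j : Fin 2 => if i.val + j.val + 1 = 2 then (1 : L) else 0)).Local v ×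
      (cmDatum L 1 (Matrix.of fun i j : Fin 1 => if i.val + j.val + 1 = 1 then (1 : L) else 0)).Local v)]
    [∀ a : ((cmDatum L 2 (Matrix.of fun i j : Fin 2 => if i.val + j.val + 1 = 2 then (1 : L) else 0)).Local v ×
      (cmDatum L 1 (Matrix.of fun i j : Fin 1 => if i.val + j.val + 1 = 1 then (1 : L) else 0)).Local v),
      MeasurableSpace (((cmDatum L 2 (Matrix.of fun i j : Fin 2 => if i.val + j.val + 1 = 2 then (1 : L) else 0)).Local v ×
      (cmDatum L 1 (Matrix.of fun i j : Fin 1 => if i.val + j.val + 1 = 1 then (1 : L) else 0)).Local v) ⧸ Subgroup.centralizer ({a} : Set ((cmDatum L 2 (Matrix.of fun i j : Fin 2 => if i.val + j.val + 1 = 2 then (1 : L) else 0)).Local v ×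
      (cmDatum L 1 (Matrix.of fun i j : Fin 1 => if i.val + j.val + 1 = 1 then (1 : L) else 0)).Local v)))]
    [∀ a : ((cmDatum L 2 (Matrix.of fun i j : Fin 2 => if i.val + j.val + 1 = 2 then (1 : L) else 0)).Local v ×
      (cmDatum L 1 (Matrix.of fun i j : Fin 1 => if i.val + j.val + 1 = 1 then (1 : L) else 0)).Local v),
      BorelSpace (((cmDatum L 2 (Matrix.of fun i j : Fin 2 => if i.val + j.val + 1 = 2 then (1 : L) else 0)).Local v ×
      (cmDatum L 1 (Matrix.of fun i j : Fin 1 => if i.val + j.val + 1 = 1 then (1 : L) else 0)).Local v) ⧸ Subgroup.centralizer ({a} : Set ((cmDatum L 2 (Matrix.of fun i j : Fin 2 => if i.val + j.val + 1 = 2 then (1 : L) else 0)).Local v ×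
      (cmDatum L 1 (Matrix.of fun i j : Fin 1 => if i.val + j.val + 1 = 1 then (1 : L) else 0)).Local v)))]
    (νH : Measure ((cmDatum L 2 (Matrix.of fun i j : Fin 2 => if i.val + j.val + 1 = 2 then (1 : L) else 0)).Local v ×
      (cmDatum L 1 (Matrix.of fun i j : Fin 1 => if i.val + j.val + 1 = 1 then (1 : L) else 0)).Local v)) [νH.IsHaarMeasure] [νH.IsMulRightInvariant]
    (νG : Measure ((cmDatum L 3 H').Local v)) [νG.IsHaarMeasure] [νG.IsMulRightInvariant]
    {mH : OrbitalMeasureFamily ((cmDatum L 2 (Matrix.of fun i j : Fin 2 => if i.val + j.val + 1 = 2 then (1 : L) else 0)).Local v ×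
      (cmDatum L 1 (Matrix.of fun i j : Fin 1 => if i.val + j.val + 1 = 1 then (1 : L) else 0)).Local v)} {mG : OrbitalMeasureFamily ((cmDatum L 3 H').Local v)}
    (hmH : mH.IsCanonical (IsLocalGRegular L v) νH)
    (hmG : mG.IsCanonical (fun γ => IsRegularElt (γ.val : GL (Fin 3) (UnitaryGroup.LocalRing L v))) νG)
    -- the piece: Borel, `Ad K′`-invariant, LEFT-INVARIANT under the `v`-level-1 congruence set `K(ϖ_v)` (END fold v6 `stub_levelOneRowsRam` :118 token `hg1` VERBATIM)
    (g : ((cmDatum L 3 H').Local v) → ℂ) (hgm : Measurable g)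
    (hginv : ∀ u ∈ cmLocalIntegralLevel L 3 H' v, ∀ x, g (u * x * u⁻¹) = g x)
    (hg1 : ∀ u : (cmDatum L 3 H').Local v,
      (∀ a b, Valued.v (((toPlace v w (HeckeCharacter.uniformizer ↥(maximalRealSubfield L) v : v.adicCompletion ↥(maximalRealSubfield L))) ^ 1)⁻¹ *
        ((((localNonsplitEquiv (IsCMField.complexConj L) H' (IsCMField.complexConj_ne_one L) w hw u :
            ↥(unitaryGroupOfForm (galAdicCompletionMap (L := L) (IsCMField.complexConj L) hw) (placeForm H' w.1))) : GL (Fin 3) (w.1.adicCompletion L)) :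
              Matrix (Fin 3) (Fin 3) (w.1.adicCompletion L)) a b - (1 : Matrix (Fin 3) (Fin 3) (w.1.adicCompletion L)) a b)) ≤ 1) →
      ∀ x, g (u * x) = g x)
    (X : ℂ)
    -- SOCKET (the `𝔭`-layer strata enter ONLY here): the `N ∩ K₃`-integral of `g` through every level frame with integral matrix reading, any Haar `μ_N`
    (hN : ∀ [MeasurableSpace ↥(unitaryGroupOfForm (conjLocal L (IsCMField.complexConj L) v) (cmLocalForm L 3 v))] [BorelSpace ↥(unitaryGroupOfForm (conjLocal L (IsCMField.complexConj L) v) (cmLocalForm L 3 v))]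
      (ψ : (cmDatum L 3 H').Local v ≃ₜ* ↥(unitaryGroupOfForm (conjLocal L (IsCMField.complexConj L) v) (cmLocalForm L 3 v)))
      (_hψK : ∀ g : (cmDatum L 3 H').Local v, ψ g ∈ cmLocalIntegralLevel L 3 (Matrix.of fun i j : Fin 3 => if i.val + j.val + 1 = 3 then (1 : L) else 0) v ↔ g ∈ cmLocalIntegralLevel L 3 H' v)
      (_hψc : ∀ g : (cmDatum L 3 H').Local v, IsConj (g.val : GL (Fin 3) (LocalRing L v)) ((ψ g : ↥(unitaryGroupOfForm (conjLocal L (IsCMField.complexConj L) v) (cmLocalForm L 3 v))) : GL (Fin 3) (LocalRing L v)))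
      (T : GL (Fin 3) (w.1.adicCompletion L)) (_hT : T ∈ glInt 3 (w.1.adicCompletion L))
      (_hψT : ∀ g : (cmDatum L 3 H').Local v, localGLPiEquiv L 3 v (((ψ g : ↥(unitaryGroupOfForm (conjLocal L (IsCMField.complexConj L) v) (cmLocalForm L 3 v)))) : GL (Fin 3) (LocalRing L v)) w =
        T * localGLPiEquiv L 3 v (g.val : GL (Fin 3) (LocalRing L v)) w * T⁻¹)
      (μN : Measure ↥(unipotentU (conjLocal L (IsCMField.complexConj L) v) (cmLocalForm L 3 v))) [μN.IsHaarMeasure],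
      ∫ n, g (ψ.symm (n : ↥(unitaryGroupOfForm (conjLocal L (IsCMField.complexConj L) v) (cmLocalForm L 3 v)))) ∂μN =
        (μN.real {n : ↥(unipotentU (conjLocal L (IsCMField.complexConj L) v) (cmLocalForm L 3 v)) |
            (n : ↥(unitaryGroupOfForm (conjLocal L (IsCMField.complexConj L) v) (cmLocalForm L 3 v))) ∈
              cmLocalIntegralLevel L 3 (Matrix.of fun i j : Fin 3 => if i.val + j.val + 1 = 3 then (1 : L) else 0) v} : ℂ) * X)
    -- the C-Δ LEVI VALUE is DISCHARGED (★ p846910, p07 (g12)): guard `μ|_{𝕀_{L⁺}} = ω` and `y_λ ∈ L⁺_v` with `ι_w y_λ = −det H′_w` (the core's epsilon is `(y_λ, θ)_v`)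
    (hμω : ∀ x : ideleGroup ↥(maximalRealSubfield L), μ (AdeleRing.ideleBaseChange ↥(maximalRealSubfield L) L x) = quadraticHeckeCharCM L x)
    (yl : v.adicCompletion ↥(maximalRealSubfield L)) (hyl : toPlace v w yl = -(placeForm H' w.1).det)
    -- the TEST FAMILY (fold v6 :118 shape `∃ r ψ a`) with its LEVI PROPORTIONALITY CONSTANTS `yv`; SOCKET `hψ`: near `1`, `Φ^st(γ_H, ψH s) = yv s·Φ^st(γ_H, χ₀)` on 1-deep regular Levi `γ_H`
    {r : ℕ} (ψH : Fin r → ((cmDatum L 2 (Matrix.of fun i j : Fin 2 => if i.val + j.val + 1 = 2 then (1 : L) else 0)).Local v ×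
        (cmDatum L 1 (Matrix.of fun i j : Fin 1 => if i.val + j.val + 1 = 1 then (1 : L) else 0)).Local v) → ℂ) (yv a : Fin r → ℂ)
    (hψ : ∃ Vψ ∈ 𝓝 (1 : ((cmDatum L 2 (Matrix.of fun i j : Fin 2 => if i.val + j.val + 1 = 2 then (1 : L) else 0)).Local v ×
        (cmDatum L 1 (Matrix.of fun i j : Fin 1 => if i.val + j.val + 1 = 1 then (1 : L) else 0)).Local v)),
      ∀ γH ∈ Vψ, IsLocalGRegular L v γH →
        ∀ (y : ((cmDatum L 2 (Matrix.of fun i j : Fin 2 => if i.val + j.val + 1 = 2 then (1 : L) else 0)).Local v ×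
        (cmDatum L 1 (Matrix.of fun i j : Fin 1 => if i.val + j.val + 1 = 1 then (1 : L) else 0)).Local v)) (d' : Fin 2 → (UnitaryGroup.LocalRing L v)ˣ),
          glDiagonal 2 (UnitaryGroup.LocalRing L v) d' = ((y * γH * y⁻¹).1.val : GL (Fin 2) (UnitaryGroup.LocalRing L v)) →
          (∀ i : Fin 2, Valued.v ((((d' i : (UnitaryGroup.LocalRing L v)ˣ) : UnitaryGroup.LocalRing L v) w) - 1) < 1) →
          ∀ s, stableOrbitalIntegralRel (IsLocalStablyConjH L v) mH (ψH s) γH =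
            yv s * stableOrbitalIntegralRel (IsLocalStablyConjH L v) mH
                ((((cmLocalIntegralLevel L 2 (Matrix.of fun i j : Fin 2 => if i.val + j.val + 1 = 2 then (1 : L) else 0) v).prod
                (cmLocalIntegralLevel L 1 (Matrix.of fun i j : Fin 1 => if i.val + j.val + 1 = 1 then (1 : L) else 0) v) : Subgroup _) : Set _).indicator
              (fun h => if (redMat (((h.1.val : GL (Fin 2) (UnitaryGroup.LocalRing L v)).val.map (Pi.evalRingHom (fun w' : PlacesOver L v => w'.1.adicCompletion L) w))) - 1) ^ 2 = 0 ∧ (redMat (((h.1.val : GL (Fin 2) (UnitaryGroup.LocalRing L v)).val.map (Pi.evalRingHom (fun w' : PlacesOver L v => w'.1.adicCompletion L) w))) - 1).rank = 0 then (1 : ℂ) else 0)) γH)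
    -- the coefficient test: ONE linear relation on `a`; `X` = the `N ∩ K₃`-average of `g∘ψ⁻¹` (socket `hN`)
    (ha : (∑ s, a s * yv s) * (νH.real (((cmLocalIntegralLevel L 2 (Matrix.of fun i j : Fin 2 => if i.val + j.val + 1 = 2 then (1 : L) else 0) v).prod
                (cmLocalIntegralLevel L 1 (Matrix.of fun i j : Fin 1 => if i.val + j.val + 1 = 1 then (1 : L) else 0) v) : Subgroup _) : Set _) : ℂ) =
            (hilbertSymbol (v.adicCompletion ↥(maximalRealSubfield L)) yl
        (algebraMap ↥(maximalRealSubfield L) _ ((cmQuadraticGenerator L : 𝓞 ↥(maximalRealSubfield L)) : ↥(maximalRealSubfield L))) : ℂ) *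
        (νG.real (cmLocalIntegralLevel L 3 H' v : Set ((cmDatum L 3 H').Local v)) : ℂ) * X) :
        ∃ V ∈ 𝓝 (1 : ((cmDatum L 2 (Matrix.of fun i j : Fin 2 => if i.val + j.val + 1 = 2 then (1 : L) else 0)).Local v ×
        (cmDatum L 1 (Matrix.of fun i j : Fin 1 => if i.val + j.val + 1 = 1 then (1 : L) else 0)).Local v)),
      ∀ γH ∈ V, IsLocalGRegular L v γH →
        (∃ (y : ((cmDatum L 2 (Matrix.of fun i j : Fin 2 => if i.val + j.val + 1 = 2 then (1 : L) else 0)).Local v ×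
        (cmDatum L 1 (Matrix.of fun i j : Fin 1 => if i.val + j.val + 1 = 1 then (1 : L) else 0)).Local v)) (d' : Fin 2 → (UnitaryGroup.LocalRing L v)ˣ),
          glDiagonal 2 (UnitaryGroup.LocalRing L v) d' = ((y * γH * y⁻¹).1.val : GL (Fin 2) (UnitaryGroup.LocalRing L v))) →
        ∑ᶠ cG : ConjClasses ((cmDatum L 3 H').Local v),
            ((finExplicitCollection L H' μ (finExplicitDelta_conj_left_all L H' μ) (finExplicitDelta_conj_right_all L H' μ)) v).Δ γH (Quotient.out cG) *
              classOrbitalIntegral mG g cG =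
          ∑ s, a s * stableOrbitalIntegralRel (IsLocalStablyConjH L v) mH (ψH s) γH := by
  -- ★ p846939 §2 at `(a₀, a₁) := (∑ s, a s·yv s, 0)`
  have hw' := finsum_delta_mul_classOrbitalIntegral_eq_of_levi_ramified_levelOne_of_frame_of_integral_eq L H' μ hH' w hw he hH'w _hH'i h2 A hA hframe
    νH νG hmH hmG g hgm hginv hg1 X (∑ s, a s * yv s) 0 hN hμω yl hyl ha
  obtain ⟨V, hV1, hVc⟩ := hw'
  obtain ⟨Vψ, hVψ1, hVψ⟩ := hψ
  obtain ⟨V₁, hV₁1, hV₁⟩ := exists_nhds_one_forall_levi_deep L v w  -- 1-deepness of the Levi eigenvalues near `1`, fed to `hψ`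
  refine ⟨V ∩ (Vψ ∩ V₁), Filter.inter_mem hV1 (Filter.inter_mem hVψ1 hV₁1), fun γH hγ hreg hlev => ?_⟩
  have h1 := hVc γH hγ.1 hreg hlev
  obtain ⟨y, d', hyd'⟩ := hlev
  have ht1 : ∀ i : Fin 2, Valued.v ((((d' i : (UnitaryGroup.LocalRing L v)ˣ) : UnitaryGroup.LocalRing L v) w) - 1) < 1 := by
    have h3 := hV₁ γH hγ.2.2 y _ (endoEmbLocal_eq_glDiagonal_of_fst_eq L v (y * γH * y⁻¹) hyd')
    intro i
    fin_cases i
    · exact h3 0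
    · exact h3 2
  have h2 := hVψ γH hγ.2.1 hreg y d' hyd' ht1
  rw [h1, zero_mul, add_zero, Finset.sum_mul]
  exact Finset.sum_congr rfl fun s _ => by rw [h2 s]; ring

end Literature.NumberTheory.Rogawski1990

end
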